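import Summits.CriticalPhenomena.CardyFormulaZ2.Theorems.CardyMagicRigidityNestingRigidityNeckCoarseZ2Surrogate
import Summits.CriticalPhenomena.CardyFormulaZ2.Theorems.CardyMagicRigidityNestingRigidityNeckZ2CoveringA
import Summits.CriticalPhenomena.CardyFormulaZ2.Theorems.CardyMagicRigidityNestingRigidityNeckZ2CoveringB
import HarnessLib

/-!
# Crux `NestingRigidity`, line `pinch-resampling` (v4), stub S12: the error of the surrogate is covered by multi-scale four-arm node events

Crux `Summit.CriticalPhenomena.CardyFormulaZ2.Theses.CardyMagicRigidity.NestingRigidity`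
(stmt-CriticalPhenomena-4835), line `pinch-resampling` v4, stub S12 `stub_neckHookupCoarseZ2 : NeckHookupCoarseZ2`.
Assembly of the deterministic half of the remaining estimate `ZHookStarBound` (`…NeckCoarseZ2Surrogate`,
`neckHookupCoarseZ2_of_hookStarBound : ZHookStarBound → NeckHookupCoarseZ2`) from the covering lemmas
`NeckCoarseZ2.zCovering_A` (`…NeckZ2CoveringA`) and `NeckCoarseZ2.zCovering_B` (`…NeckZ2CoveringB`):

* §1 The two NODE EVENTS, pure percolation events of a lattice configuration (no surrogate, no conditional
  probability): `ZNodeEventA ℓ lam s x o` — a nonempty finite family of virtual edges (same-`ℓ`-cell pairs of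
  inner-layer vertices, the second in a big blob) every separated sub-family of which is surrounded, at every pair of
  admissible radii, by the tree's cluster-form four-arm event `fourArmTwoClustersAt w r R`; `ZNodeEventB lam s x` — the
  same for a nonempty finite family of inner-layer vertices of SMALL blobs, which moreover is a "touching necklace"
  (every blob of the family is joined by an open edge to both sides of a disconnection avoiding the family).
* §2 **The error decomposition** `symmDiff_zHookR_zHookStar_subset`: on lattice configurations (`P_{1/2}`-a.s.) and for
  `1 ≤ ℓ`, `lam + 1 ≤ s`, `ZHookR Δ ZHookStar ⊆ ZNodeEventA ∪ ZNodeEventB` — 𝔄 (`ZHookStar ∖ ZHookR`) by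
  `exists_stepChain_of_fuzzyHook` + `zCovering_A` with the link graph `zIntGraph x s ω`, 𝔅 (`ZHookR ∖ ZHookStar ⊆
  ZHookR ∖ ZHookBig`, the easy half of the sandwich `fuzzyHook_of_zHookBig`) by `zCovering_B`.
* §3 **The reduction of S12 to two node-event bounds** (`zHookStarBound_of_nodeBounds`, registered anchor):
  `ZNodeBoundA → ZNodeBoundB → ZHookStarBound`, where `ZNodeBoundA/B : Prop` (NOT asserted) say that in the window the
  node events have probability `≤ b · P(ZFourStrands x s)`.  What they cost (S11 road map, item 2, and the S12 notes):
  the two-radius four-arm bound with exponent `> 1` — IN THE TREE for bond `ℤ²` (`QuadCrossing.fourArm_bound`,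
  `real_fourArmTwoClustersAt`), independence over disjoint annuli, a multi-scale summation over the single-linkage
  hierarchy of the family (an UNBOUNDED number of fuzzy junctions: a plain union bound over cells does not tend to
  `0` in the window), RSW positivity of `ZFourStrands` at ratio `2`, and for 𝔅 a touching-necklace bound.
-/

noncomputable section

namespace Summit.CriticalPhenomena.CardyFormulaZ2.Cruxes.NestingRigidity.PinchResampling

open MeasureTheory Set Literature.Probability.Percolation Literature.Probability.LatticeModels
open ZPinchLocality
open NeckCoarseZ2
open scoped symmDiff

/-! ## §1 The node events -/

/-- **Node event for `𝔄`**: a nonempty finite family `F` of virtual edges such that for every nonempty sub-family `𝒩`,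
every inner-layer centre `w` with the locales of `𝒩` inside `Λ_Δ(w)` and those of `F ∖ 𝒩` at sup distance `≥ Γ`, and
all radii `Δ + ℓ ≤ r ≤ R`, `R + ℓ ≤ Γ`, `R + 1 ≤ s`, the cluster-form four-arm event `fourArmTwoClustersAt w r R`
holds. -/
def ZNodeEventA (ℓ lam s : ℕ) (x o : Site 2) : Set (BondConfig (Site 2)) :=
  {ω | ∃ F : Finset (Site 2 × Site 2), ↑F ⊆ zVEdges ℓ lam s x o ω ∧ F.Nonempty ∧
    ∀ 𝒩 ⊆ F, 𝒩.Nonempty → ∀ (w : Site 2) (Δ r R Γ : ℕ),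
      w ∈ innerLayer (zdGraph 2) (zBall x s) (zBall x (2 * s)) →
      (∀ e ∈ 𝒩, zNorm (e.2 - w) ≤ Δ) → (∀ e ∈ F, e ∉ 𝒩 → (Γ : ℤ) ≤ zNorm (e.2 - w)) →
      Δ + ℓ ≤ r → r ≤ R → R + ℓ ≤ Γ → R + 1 ≤ s → ω ∈ fourArmTwoClustersAt w r R}

/-- **Node event for `𝔅`**: a nonempty finite family `F` of inner-layer vertices of SMALL blobs (sup diameter `< lam`),
forming a touching necklace between two open crossings `v, v'` not joined by an open path of `Λ_{2s}(x)` avoiding the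
blobs of `F`, such that for every nonempty sub-family `𝒩`, every inner-layer centre `w` with `𝒩 ⊆ Λ_Δ(w)` and `F ∖ 𝒩`
at sup distance `≥ Γ`, and all radii `Δ + lam + 1 ≤ r ≤ R`, `R + lam ≤ Γ`, `R + 1 ≤ s`, the cluster-form four-arm
event `fourArmTwoClustersAt w r R` holds. -/
def ZNodeEventB (lam s : ℕ) (x : Site 2) : Set (BondConfig (Site 2)) :=
  {ω | ∃ F : Finset (Site 2), (∀ c ∈ F, c ∈ innerLayer (zdGraph 2) (zBall x s) (zBall x (2 * s)) ∧
      ¬ ∃ w ∈ blobOf (openGraph ω) (zBall x (2 * s) \ zBall x s) c,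
        ∃ w' ∈ blobOf (openGraph ω) (zBall x (2 * s) \ zBall x s) c, (lam : ℤ) ≤ zNorm (w - w')) ∧
    F.Nonempty ∧
    (∃ v v' : Site 2, IsCrossing (zdGraph 2) (openGraph ω) (zBall x s) (zBall x (2 * s)) v ∧
      IsCrossing (zdGraph 2) (openGraph ω) (zBall x s) (zBall x (2 * s)) v' ∧
      ¬ PathIn (openGraph ω) (zAvoid s x ω ↑F) v v' ∧
      ∀ c ∈ F, ∃ a₁ c₁ a₂ c₂, PathIn (openGraph ω) (zAvoid s x ω ↑F) v a₁ ∧ (openGraph ω).Adj a₁ c₁ ∧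
        c₁ ∈ blobOf (openGraph ω) (zBall x (2 * s) \ zBall x s) c ∧
        PathIn (openGraph ω) (zAvoid s x ω ↑F) v' a₂ ∧ (openGraph ω).Adj a₂ c₂ ∧
        c₂ ∈ blobOf (openGraph ω) (zBall x (2 * s) \ zBall x s) c) ∧
    ∀ 𝒩 ⊆ F, 𝒩.Nonempty → ∀ (w : Site 2) (Δ r R Γ : ℕ),
      w ∈ innerLayer (zdGraph 2) (zBall x s) (zBall x (2 * s)) →
      (∀ c ∈ 𝒩, zNorm (c - w) ≤ Δ) → (∀ c ∈ F, c ∉ 𝒩 → (Γ : ℤ) ≤ zNorm (c - w)) →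
      Δ + lam + 1 ≤ r → r ≤ R → R + lam ≤ Γ → R + 1 ≤ s → ω ∈ fourArmTwoClustersAt w r R}

/-! ## §2 The error decomposition -/

/-- On a lattice configuration the open graph is a subgraph of the lattice. -/
theorem NeckCoarseZ2.openGraph_adj_lattice {ω : BondConfig (Site 2)} (hω : ω ⊆ (zdGraph 2).edgeSet) :
    ∀ a b, (openGraph ω).Adj a b → (zdGraph 2).Adj a b := fun a b h ↦
  (SimpleGraph.mem_edgeSet _).1 (hω ((openGraph_adj ω a b).1 h).1)

/-- The interior lattice graph is a subgraph of the open graph. -/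
theorem NeckCoarseZ2.zIntGraph_le_openGraph (x : Site 2) (s : ℕ) (ω : BondConfig (Site 2)) :
    zIntGraph x s ω ≤ openGraph ω := fun a b h ↦
  (openGraph_adj ω a b).2 ⟨h.2.1, h.1.ne⟩

/-- **The error decomposition of the surrogate**: on lattice configurations, for `1 ≤ ℓ` and `lam + 1 ≤ s`, the
symmetric difference of the primal hook-up and the fuzzy hook-up is covered by the two node events. -/
theorem symmDiff_zHookR_zHookStar_subset {ℓ lam s : ℕ} (x o : Site 2) (hℓ : 1 ≤ ℓ) (hls : lam + 1 ≤ s) :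
    (ZHookR x s ∆ ZHookStar ℓ lam s x o) ∩ {ω | ω ⊆ (zdGraph 2).edgeSet} ⊆
      ZNodeEventA ℓ lam s x o ∪ ZNodeEventB lam s x := by
  rintro ω ⟨hΔ, hω⟩
  have hHG := NeckCoarseZ2.openGraph_adj_lattice hω
  rcases mem_symmDiff.1 hΔ with ⟨hH, hnS⟩ | ⟨hS, hnH⟩
  · -- 𝔅: an honest hook-up which is not fuzzy is not a hook-up through the big blobs
    right
    have hnB : ω ∉ ZHookBig lam s x := fun hB ↦ hnS
      (fuzzyHook_of_zHookBig (ℓ := ℓ) (o := o) hHG (Z := zIntGraph x s ω) (fun _ _ h1 h2 h3 ↦ ⟨h1, h2, h3⟩) hB)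
    obtain ⟨F, hF, hne, hside, hnode⟩ := zCovering_B hHG hls hH hnB
    exact ⟨F, hF, hne, hside, hnode⟩
  · -- 𝔄: a fuzzy hook-up which is not honest
    left
    obtain ⟨b, b', hb, hb', hnR, hchain⟩ :=
      exists_stepChain_of_fuzzyHook hls (NeckCoarseZ2.zIntGraph_le_openGraph x s ω) hS hnH
    obtain ⟨F, hF, hne, hnode⟩ := zCovering_A hHG hℓ hb hb' hnR hchain
    exact ⟨F, hF, hne, hnode⟩

/-! ## §3 S12 from two node-event bounds -/

/-- **Node-event bound for `𝔄`** (a statement, NOT asserted): in the window, `ZNodeEventA` has probability at most `b`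
times that of the selection event. -/
def ZNodeBoundA : Prop :=
  ∀ b : ℝ, 0 < b → ∃ L : ℕ, ∀ (x o : Site 2) (ℓ lam s : ℕ), 1 ≤ ℓ → s ^ 3 * ℓ ≤ lam ^ 4 → L * lam ≤ s →
    (bondPercolation (zdGraph 2) half).real (ZFourStrands x s ∩ ZNodeEventA ℓ lam s x o) ≤
      b * (bondPercolation (zdGraph 2) half).real (ZFourStrands x s)

/-- **Node-event bound for `𝔅`** (a statement, NOT asserted): in the window, `ZNodeEventB` has probability at most `b`
times that of the selection event. -/
def ZNodeBoundB : Prop :=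
  ∀ b : ℝ, 0 < b → ∃ L : ℕ, ∀ (x : Site 2) (lam s : ℕ), L * lam ≤ s →
    (bondPercolation (zdGraph 2) half).real (ZFourStrands x s ∩ ZNodeEventB lam s x) ≤
      b * (bondPercolation (zdGraph 2) half).real (ZFourStrands x s)

/-- For radius `0` the collar is empty: there are no crossings and the selection event is empty. -/
theorem NeckCoarseZ2.zFourStrands_zero (x : Site 2) : ZFourStrands x 0 = ∅ := by
  ext ω
  simp only [mem_empty_iff_false, iff_false]
  rintro ⟨⟨⟨v, -, hv, -⟩, -⟩, -⟩
  have h1 : v ∈ zBall x (2 * 0) := hv.1.1.1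
  have h2 : v ∉ zBall x 0 := hv.1.1.2
  exact h2 (by simpa using h1)

/-- **S12 reduces to the two node-event bounds (registered helper, anchor of this module on the crux item).**  With
`neckHookupCoarseZ2_of_hookStarBound` (`…NeckCoarseZ2Surrogate`): `ZNodeBoundA → ZNodeBoundB → NeckHookupCoarseZ2`. -/
theorem zHookStarBound_of_nodeBounds : ZNodeBoundA → ZNodeBoundB → ZHookStarBound := by
  intro hA hB b hb
  obtain ⟨L₁, hL₁⟩ := hA (b / 2) (by positivity)
  obtain ⟨L₂, hL₂⟩ := hB (b / 2) (by positivity)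
  refine ⟨max (max L₁ L₂) 2, fun x o ℓ lam s hℓ hw hLs ↦ ?_⟩
  set μ := bondPercolation (zdGraph 2) half with hμ
  have hL₁s : L₁ * lam ≤ s := le_trans (Nat.mul_le_mul_right lam ((le_max_left _ _).trans (le_max_left _ _))) hLs
  have hL₂s : L₂ * lam ≤ s := le_trans (Nat.mul_le_mul_right lam ((le_max_right _ _).trans (le_max_left _ _))) hLs
  have h2s : 2 * lam ≤ s := le_trans (Nat.mul_le_mul_right lam (le_max_right _ _)) hLs
  -- degenerate radius: `lam = 0` forces `s = 0` unless `1 ≤ s`; for `s = 0` the selection event is empty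
  rcases Nat.eq_zero_or_pos s with rfl | hs
  · simp [NeckCoarseZ2.zFourStrands_zero]
  have hls : lam + 1 ≤ s := by
    rcases Nat.eq_zero_or_pos lam with rfl | hlam
    · omega
    · omega
  -- discard the non-lattice configurations (a null set) and apply the decomposition
  have hae : ∀ᵐ ω ∂μ, ω ⊆ (zdGraph 2).edgeSet := ae_subset_edgeSet (zdGraph 2) half
  have hcover : ZFourStrands x s ∩ (ZHookR x s ∆ ZHookStar ℓ lam s x o) ∩ {ω | ω ⊆ (zdGraph 2).edgeSet} ⊆
      ZFourStrands x s ∩ ZNodeEventA ℓ lam s x o ∪ ZFourStrands x s ∩ ZNodeEventB lam s x := by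
    rintro ω ⟨⟨hSel, hΔ⟩, hω⟩
    rcases symmDiff_zHookR_zHookStar_subset x o hℓ hls ⟨hΔ, hω⟩ with h | h
    · exact Or.inl ⟨hSel, h⟩
    · exact Or.inr ⟨hSel, h⟩
  have heq : μ.real (ZFourStrands x s ∩ (ZHookR x s ∆ ZHookStar ℓ lam s x o)) =
      μ.real (ZFourStrands x s ∩ (ZHookR x s ∆ ZHookStar ℓ lam s x o) ∩ {ω | ω ⊆ (zdGraph 2).edgeSet}) := by
    refine measureReal_congr (Filter.eventuallyEq_set.2 (hae.mono fun ω hω ↦ ?_))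
    simp only [mem_inter_iff, mem_setOf_eq, hω, and_true]
  calc μ.real (ZFourStrands x s ∩ (ZHookR x s ∆ ZHookStar ℓ lam s x o))
      = μ.real (ZFourStrands x s ∩ (ZHookR x s ∆ ZHookStar ℓ lam s x o) ∩ {ω | ω ⊆ (zdGraph 2).edgeSet}) := heq
    _ ≤ μ.real (ZFourStrands x s ∩ ZNodeEventA ℓ lam s x o ∪ ZFourStrands x s ∩ ZNodeEventB lam s x) :=
        measureReal_mono hcover (measure_ne_top _ _)
    _ ≤ μ.real (ZFourStrands x s ∩ ZNodeEventA ℓ lam s x o) + μ.real (ZFourStrands x s ∩ ZNodeEventB lam s x) :=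
        measureReal_union_le _ _
    _ ≤ b / 2 * μ.real (ZFourStrands x s) + b / 2 * μ.real (ZFourStrands x s) :=
        add_le_add (hL₁ x o ℓ lam s hℓ hw hL₁s) (hL₂ x lam s hL₂s)
    _ = b * μ.real (ZFourStrands x s) := by ring

/-- **S12 from the two node-event bounds** (composition with the surrogate reduction). -/
theorem neckHookupCoarseZ2_of_nodeBounds (hA : ZNodeBoundA) (hB : ZNodeBoundB) : NeckHookupCoarseZ2 :=
  neckHookupCoarseZ2_of_hookStarBound (zHookStarBound_of_nodeBounds hA hB)

/-! ## §4 Relative bounds from absolute bounds and RSW positivity of the selection event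

The node-event bounds are RELATIVE to `P(ZFourStrands x s)`.  They follow from ABSOLUTE bounds on the node events (what a
multi-scale summation of `real_biInter_fourArmTwoClustersAt_le_prod_rpow`-type products delivers) and the RSW positivity
of the selection event at ratio `2` — three statements (NOT asserted) isolating exactly what is still missing for S12. -/

/-- **RSW positivity of the selection event at ratio `2`** (a statement, NOT asserted; absent from the tree): exactly
two primal-open crossing clusters of `Λ_{2s}(x) ∖ Λ_s(x)` and exactly two dual-open crossing clusters of the dual collar
occur with probability `≥ c₀ > 0`, uniformly in the centre and in `s ≥ s₀`.  (Russo–Seymour–Welsh for bond `ℤ²` at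
`p = 1/2` with blocking dual arcs; the `ℤ²` twin of S11's `TPinchPositive`.) -/
def ZFourStrandsPositive : Prop :=
  ∃ s₀ : ℕ, ∃ c₀ : ℝ, 0 < c₀ ∧ ∀ (x : Site 2) (s : ℕ), s₀ ≤ s → c₀ ≤ (bondPercolation (zdGraph 2) half).real (ZFourStrands x s)

/-- **Absolute node-event bound for `𝔄`** (a statement, NOT asserted): in the window the node event `ZNodeEventA` has
probability `≤ b`.  (Content: the multi-scale summation over the single-linkage hierarchy of the virtual-edge family of
the products of four-arm node events, `real_biInter_fourArmTwoClustersAt_le_prod_rpow`; heuristic total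
`O((ℓ/s)^{ε}) · polylog`.) -/
def ZNodeAbsBoundA : Prop :=
  ∀ b : ℝ, 0 < b → ∃ L : ℕ, ∀ (x o : Site 2) (ℓ lam s : ℕ), 1 ≤ ℓ → s ^ 3 * ℓ ≤ lam ^ 4 → L * lam ≤ s →
    (bondPercolation (zdGraph 2) half).real (ZNodeEventA ℓ lam s x o) ≤ b

/-- **Absolute node-event bound for `𝔅`** (a statement, NOT asserted): for `1 ≤ lam` and `L · lam ≤ s` the node event
`ZNodeEventB` has probability `≤ b`.  (Content: the same summation at base scale `lam`, heuristic total `O((lam/s)^{ε})`,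
plus a "touching necklace" bound for dense runs of small blobs adjacent to both sides, the `ℤ²` twin of S11's
`TouchingNecklaceBoundT`.) -/
def ZNodeAbsBoundB : Prop :=
  ∀ b : ℝ, 0 < b → ∃ L : ℕ, ∀ (x : Site 2) (lam s : ℕ), 1 ≤ lam → L * lam ≤ s →
    (bondPercolation (zdGraph 2) half).real (ZNodeEventB lam s x) ≤ b

/-- With bigness threshold `lam = 0` every blob is big, so the node event for `𝔅` (which needs a SMALL blob) is empty. -/
theorem NeckCoarseZ2.zNodeEventB_zero (s : ℕ) (x : Site 2) : ZNodeEventB 0 s x = ∅ := by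
  ext ω
  simp only [mem_empty_iff_false, iff_false]
  rintro ⟨F, hF, ⟨c, hc⟩, -⟩
  obtain ⟨hcL, hsmall⟩ := hF c hc
  exact hsmall ⟨c, NeckCoarse.self_mem_blobOf hcL.1, c, NeckCoarse.self_mem_blobOf hcL.1, by
    simp [zNorm]⟩

/-- **Relative from absolute, `𝔄`.** -/
theorem zNodeBoundA_of_abs (hpos : ZFourStrandsPositive) (hA : ZNodeAbsBoundA) : ZNodeBoundA := by
  obtain ⟨s₀, c₀, hc₀, hpos⟩ := hpos
  intro b hb
  obtain ⟨L₁, hL₁⟩ := hA (b * c₀) (by positivity)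
  refine ⟨max L₁ s₀, fun x o ℓ lam s hℓ hw hLs ↦ ?_⟩
  set μ := bondPercolation (zdGraph 2) half with hμ
  have hL₁s : L₁ * lam ≤ s := le_trans (Nat.mul_le_mul_right lam (le_max_left _ _)) hLs
  rcases Nat.eq_zero_or_pos lam with rfl | hlam
  · -- `lam = 0` forces `s = 0` in the window, and the selection event is empty
    have hs : s = 0 := by
      by_contra hs
      have : 1 ≤ s ^ 3 * ℓ := Nat.one_le_iff_ne_zero.2 (by positivity)
      simp at hw
      omega
    subst hs
    simp [NeckCoarseZ2.zFourStrands_zero]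
  · have hs₀ : s₀ ≤ s := by nlinarith [le_max_right L₁ s₀]
    calc μ.real (ZFourStrands x s ∩ ZNodeEventA ℓ lam s x o) ≤ μ.real (ZNodeEventA ℓ lam s x o) :=
          measureReal_mono inter_subset_right (measure_ne_top _ _)
      _ ≤ b * c₀ := hL₁ x o ℓ lam s hℓ hw hL₁s
      _ ≤ b * μ.real (ZFourStrands x s) := mul_le_mul_of_nonneg_left (hpos x s hs₀) hb.le

/-- **Relative from absolute, `𝔅`.** -/
theorem zNodeBoundB_of_abs (hpos : ZFourStrandsPositive) (hB : ZNodeAbsBoundB) : ZNodeBoundB := by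
  obtain ⟨s₀, c₀, hc₀, hpos⟩ := hpos
  intro b hb
  obtain ⟨L₁, hL₁⟩ := hB (b * c₀) (by positivity)
  refine ⟨max L₁ s₀, fun x lam s hLs ↦ ?_⟩
  set μ := bondPercolation (zdGraph 2) half with hμ
  have hL₁s : L₁ * lam ≤ s := le_trans (Nat.mul_le_mul_right lam (le_max_left _ _)) hLs
  rcases Nat.eq_zero_or_pos lam with rfl | hlam
  · simp only [NeckCoarseZ2.zNodeEventB_zero, inter_empty, measureReal_empty]
    positivity
  · have hs₀ : s₀ ≤ s := by nlinarith [le_max_right L₁ s₀]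
    calc μ.real (ZFourStrands x s ∩ ZNodeEventB lam s x) ≤ μ.real (ZNodeEventB lam s x) :=
          measureReal_mono inter_subset_right (measure_ne_top _ _)
      _ ≤ b * c₀ := hL₁ x lam s hlam hL₁s
      _ ≤ b * μ.real (ZFourStrands x s) := mul_le_mul_of_nonneg_left (hpos x s hs₀) hb.le

/-- **S12 from RSW positivity of the selection event and the two absolute node-event bounds** — the exact remaining
inputs of stub S12 after this line of bricks. -/
theorem neckHookupCoarseZ2_of_inputs (hpos : ZFourStrandsPositive) (hA : ZNodeAbsBoundA) (hB : ZNodeAbsBoundB) :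
    NeckHookupCoarseZ2 :=
  neckHookupCoarseZ2_of_nodeBounds (zNodeBoundA_of_abs hpos hA) (zNodeBoundB_of_abs hpos hB)

end Summit.CriticalPhenomena.CardyFormulaZ2.Cruxes.NestingRigidity.PinchResampling

end
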